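import Mathlib.Tactic
import HarnessLib
import HarnessLib.Audit.Tags
import Summits.CriticalPhenomena.PercolationContinuityZ3.Theorems.PercNearOneGluingNoHeavyLowerTailSahiAntichainSplitSeven

/-!
# Antichains, meets plus joins: two members above with at most one new join force many new meets (lemma T2-LOWY)

Support file (seat `prim-masterthm-p1`, gen 37; `--supports stmt-CriticalPhenomena-4575`).  No `sorry`, no new definitions, standard
axioms.  Memo `run/shared/lean/prim/prim-masterthm/FROM-prim-masterthm-p1-g37-LINEAR-REDUCTION.md` §8.5.

SETTING: V5 is reduced to L4 and L3, and L3 to the `2 + 3` statement H23 (`…TwoFour`: at a point with two members above and three below,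
`f(below) + newLabels ≥ 8`).  The three cases of H23 (below a sunflower / co-sunflower / five-label triple) share a first step, proved here.

NEW HERE ([this work], gen 37), for a point `r` with exactly two members `a, a'` above (`u = a ∪ a'`):
* `two_mul_card_below_le_card_newMeets_of_union_eq` (CORE): if every member `b` below has `a ∪ b = a' ∪ b` and the cross joins through `a` form a
  chain, then BOTH rows of cross meets consist of new, pairwise distinct sets and the rows are disjoint: `2 · #below ≤ #newMeets`
  (every meet of two members below contains `a' \\ a ≠ ∅`, which no `a ∩ b` contains; `a ∩ b = a ∩ b'` with `a ∪ b ⊆ a ∪ b'` gives `b ⊆ b'`).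
* `two_mul_card_below_le_card_newMeets_of_newJoins_eq_empty` (y = 0): if no cross join is new then `2 · #below ≤ #newMeets`.
* `card_below_le_card_newMeets_of_newJoins_le_one` (**T2-LOWY**): if at most one cross join is new then `#below ≤ #newMeets`
  [either a row of cross joins is constant (kernel `card_below_le_card_newMeets_of_union_const`), or the unique new join `W* ⊋ u` is the
  cross join of every member below that has one, on both rows, and CORE applies].
So for a three-member side below: `newJoins = 0 ⟹ newLabels ≥ 6`, `newJoins = 1 ⟹ newLabels ≥ 4`; the H23 sub-lemmas may assume `newJoins ≥ 2`.
HONEST FRAMING: unconditional; H23, L3 (in Lean), L4, V5 remain OPEN. [this work]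
-/

namespace Summit.CriticalPhenomena.PercolationContinuityZ3.Theorems.SahiColouredDaykin

open Finset

variable {α : Type*} [DecidableEq α]

section TwoAbove

variable {P : Finset (Finset α)} {r : α} {a a' : Finset α}

/-- **CORE.**  Two members `a ≠ a'` above; every `b` below has `a ∪ b = a' ∪ b`, and the cross joins through `a` form a chain.  Then
`2 · #below ≤ #newMeets`. [this work] -/
theorem two_mul_card_below_le_card_newMeets_of_union_eq (hanti : IsAntichain (· ⊆ ·) (P : Set (Finset α)))
    (ha : a ∈ above P r) (ha' : a' ∈ above P r) (hne : a ≠ a')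
    (heq : ∀ b ∈ below P r, a ∪ b = a' ∪ b)
    (hchain : ∀ b ∈ below P r, ∀ b' ∈ below P r, a ∪ b ⊆ a ∪ b' ∨ a ∪ b' ⊆ a ∪ b) :
    2 * #(below P r) ≤ #(newMeets P r) := by
  obtain ⟨haP, hra⟩ := mem_above_iff.1 ha
  obtain ⟨ha'P, hra'⟩ := mem_above_iff.1 ha'
  -- points of `a \ a'` and `a' \ a`
  have naa' : ¬ a ⊆ a' := hanti (mem_coe.2 haP) (mem_coe.2 ha'P) hne
  have na'a : ¬ a' ⊆ a := hanti (mem_coe.2 ha'P) (mem_coe.2 haP) hne.symm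
  obtain ⟨s, hsa, hsa'⟩ := not_subset.1 naa'
  obtain ⟨t, hta', hta⟩ := not_subset.1 na'a
  -- `a \ a' ⊆ b` and `a' \ a ⊆ b` for every `b` below
  have hsb : ∀ {b : Finset α}, b ∈ below P r → s ∈ b := by
    intro b hb
    have : s ∈ a' ∪ b := by rw [← heq b hb]; exact mem_union_left _ hsa
    rcases mem_union.1 this with h | h
    · exact absurd h hsa'
    · exact h
  have htb : ∀ {b : Finset α}, b ∈ below P r → t ∈ b := by
    intro b hb
    have : t ∈ a ∪ b := by rw [heq b hb]; exact mem_union_left _ hta'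
    rcases mem_union.1 this with h | h
    · exact absurd h hta
    · exact h
  -- the chain condition transferred to the `a'` row
  have hchain' : ∀ b ∈ below P r, ∀ b' ∈ below P r, a' ∪ b ⊆ a' ∪ b' ∨ a' ∪ b' ⊆ a' ∪ b := by
    intro b hb b' hb'
    rw [← heq b hb, ← heq b' hb']
    exact hchain b hb b' hb'
  -- generic row argument: new and injective
  have row : ∀ {g : Finset α} {z : α}, g ∈ above P r → z ∉ g → (∀ {b : Finset α}, b ∈ below P r → z ∈ b) →
      (∀ b ∈ below P r, ∀ b' ∈ below P r, g ∪ b ⊆ g ∪ b' ∨ g ∪ b' ⊆ g ∪ b) →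
      (∀ b ∈ below P r, g ∩ b ∈ newMeets P r) ∧ Set.InjOn (fun b => g ∩ b) (below P r : Set (Finset α)) := by
    intro g z hg hzg hzb hch
    refine ⟨?_, ?_⟩
    · intro b hb
      rw [inter_mem_newMeets_iff hg hb]
      intro hold
      obtain ⟨d, hd, d', hd', _, hdd⟩ := mem_meets_iff.1 hold
      have : z ∈ g ∩ b := by rw [hdd]; exact mem_inter.2 ⟨hzb hd, hzb hd'⟩
      exact hzg (mem_inter.1 this).1
    · -- injectivity: equal meets and nested joins give nested members
      have key : ∀ {b b' : Finset α}, b ∈ below P r → b' ∈ below P r → g ∩ b = g ∩ b' → g ∪ b ⊆ g ∪ b' → b ⊆ b' := by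
        intro b b' hb hb' hi hu x hxb
        by_cases hxg : x ∈ g
        · have : x ∈ g ∩ b' := by rw [← hi]; exact mem_inter.2 ⟨hxg, hxb⟩
          exact (mem_inter.1 this).2
        · have : x ∈ g ∪ b' := hu (mem_union_right _ hxb)
          rcases mem_union.1 this with h | h
          · exact absurd h hxg
          · exact h
      intro b hb b' hb' hi
      have hbP := below_subset P r (mem_coe.1 hb)
      have hb'P := below_subset P r (mem_coe.1 hb')
      by_contra hbb
      rcases hch b (mem_coe.1 hb) b' (mem_coe.1 hb') with hu | hu
      · exact hanti (mem_coe.2 hbP) (mem_coe.2 hb'P) hbb (key (mem_coe.1 hb) (mem_coe.1 hb') hi hu)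
      · exact hanti (mem_coe.2 hb'P) (mem_coe.2 hbP) (Ne.symm hbb) (key (mem_coe.1 hb') (mem_coe.1 hb) hi.symm hu)
  obtain ⟨newA, injA⟩ := row ha hta (fun hb => htb hb) hchain
  obtain ⟨newA', injA'⟩ := row ha' hsa' (fun hb => hsb hb) hchain'
  -- the two rows are disjoint: `s ∈ a ∩ b`, `s ∉ a' ∩ b'`
  have hdisj : Disjoint ((below P r).image fun b => a ∩ b) ((below P r).image fun b => a' ∩ b) := by
    rw [disjoint_left]
    intro Z hZ hZ'
    obtain ⟨b, hb, rfl⟩ := mem_image.1 hZ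
    obtain ⟨b', hb', heq'⟩ := mem_image.1 hZ'
    have : s ∈ a' ∩ b' := by rw [heq']; exact mem_inter.2 ⟨hsa, hsb hb⟩
    exact hsa' (mem_inter.1 this).1
  have hsub : (below P r).image (fun b => a ∩ b) ∪ (below P r).image (fun b => a' ∩ b) ⊆ newMeets P r := by
    intro Z hZ
    rcases mem_union.1 hZ with hZ | hZ
    · obtain ⟨b, hb, rfl⟩ := mem_image.1 hZ; exact newA b hb
    · obtain ⟨b, hb, rfl⟩ := mem_image.1 hZ; exact newA' b hb
  have h1 : #((below P r).image fun b => a ∩ b) = #(below P r) := card_image_of_injOn injA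
  have h2 : #((below P r).image fun b => a' ∩ b) = #(below P r) := card_image_of_injOn injA'
  have := card_le_card hsub
  rw [card_union_of_disjoint hdisj, h1, h2] at this
  omega

/-- **y = 0.**  Two members above and no new cross join: `2 · #below ≤ #newMeets`. [this work] -/
theorem two_mul_card_below_le_card_newMeets_of_newJoins_eq_empty (hanti : IsAntichain (· ⊆ ·) (P : Set (Finset α)))
    (h2 : #(above P r) = 2) (h0 : newJoins P r = ∅) : 2 * #(below P r) ≤ #(newMeets P r) := by
  obtain ⟨a, a', hne, hA⟩ := card_eq_two.1 h2
  have ha : a ∈ above P r := by rw [hA]; simp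
  have ha' : a' ∈ above P r := by rw [hA]; simp
  have hJ : joins (above P r) = {a ∪ a'} := by rw [hA, joins_pair hne]
  have cross : ∀ {g b : Finset α}, g ∈ above P r → b ∈ below P r → g ∪ b = a ∪ a' := by
    intro g b hg hb
    have hmem : g ∪ b ∈ joins (above P r) := by
      by_contra hnot
      have : g ∪ b ∈ newJoins P r := (union_mem_newJoins_iff hg hb).2 hnot
      rw [h0] at this; exact absurd this (notMem_empty _)
    rw [hJ, mem_singleton] at hmem; exact hmem
  exact two_mul_card_below_le_card_newMeets_of_union_eq hanti ha ha' hne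
    (fun b hb => by rw [cross ha hb, cross ha' hb])
    (fun b hb b' hb' => Or.inl (by rw [cross ha hb, cross ha hb']))

/-- **T2-LOWY.**  Two members above and at most one new cross join: `#below ≤ #newMeets`. [this work] -/
theorem card_below_le_card_newMeets_of_newJoins_le_one (hanti : IsAntichain (· ⊆ ·) (P : Set (Finset α)))
    (h2 : #(above P r) = 2) (hy : #(newJoins P r) ≤ 1) : #(below P r) ≤ #(newMeets P r) := by
  obtain ⟨a, a', hne, hA⟩ := card_eq_two.1 h2
  have ha : a ∈ above P r := by rw [hA]; simp
  have ha' : a' ∈ above P r := by rw [hA]; simp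
  obtain ⟨haP, hra⟩ := mem_above_iff.1 ha
  obtain ⟨ha'P, hra'⟩ := mem_above_iff.1 ha'
  have hJ : joins (above P r) = {a ∪ a'} := by rw [hA, joins_pair hne]
  -- a cross join other than `u` is the (unique) new join
  have newJ : ∀ {g b : Finset α}, g ∈ above P r → b ∈ below P r → g ∪ b ≠ a ∪ a' → g ∪ b ∈ newJoins P r := by
    intro g b hg hb hne'
    rw [union_mem_newJoins_iff hg hb, hJ, mem_singleton]; exact hne'
  have uniq : ∀ {W W' : Finset α}, W ∈ newJoins P r → W' ∈ newJoins P r → W = W' :=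
    fun hW hW' => card_le_one.1 hy _ hW _ hW'
  by_cases hca : ∀ b ∈ below P r, a ∪ b = a ∪ a'
  · exact card_below_le_card_newMeets_of_union_const hanti ha hca
  by_cases hca' : ∀ b ∈ below P r, a' ∪ b = a ∪ a'
  · exact card_below_le_card_newMeets_of_union_const hanti ha' hca'
  push Not at hca hca'
  obtain ⟨b₁, hb₁, hne₁⟩ := hca
  obtain ⟨b₂, hb₂, hne₂⟩ := hca'
  -- the new join `W*` contains `u`
  have hW₁ := newJ ha hb₁ hne₁
  have hW₂ := newJ ha' hb₂ hne₂
  have hWeq : a ∪ b₁ = a' ∪ b₂ := uniq hW₁ hW₂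
  have huW : a ∪ a' ⊆ a ∪ b₁ := by
    apply union_subset subset_union_left
    rw [hWeq]; exact subset_union_left
  -- every cross join is `u` or `W* = a ∪ b₁`, and on each `b` both rows agree
  have val : ∀ {g b : Finset α}, g ∈ above P r → b ∈ below P r → g ∪ b = a ∪ a' ∨ g ∪ b = a ∪ b₁ := by
    intro g b hg hb
    by_cases h : g ∪ b = a ∪ a'
    · exact Or.inl h
    · exact Or.inr (uniq (newJ hg hb h) hW₁)
  have heq : ∀ b ∈ below P r, a ∪ b = a' ∪ b := by
    intro b hb
    rcases val ha hb with h1 | h1 <;> rcases val ha' hb with h2 | h2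
    · rw [h1, h2]
    · -- `a ∪ b = u`, `a' ∪ b = W* ⊇ u ⊇ a`: then `b ⊆ u` and `W* = a' ∪ b ⊆ u`, so `W* = u`
      exfalso
      have hbu : b ⊆ a ∪ a' := by rw [← h1]; exact subset_union_right
      have hWu : a ∪ b₁ ⊆ a ∪ a' := by rw [← h2]; exact union_subset subset_union_right hbu
      exact hne₁ (Subset.antisymm hWu huW)
    · exfalso
      have hbu : b ⊆ a ∪ a' := by rw [← h2]; exact subset_union_right
      have hWu : a ∪ b₁ ⊆ a ∪ a' := by rw [← h1]; exact union_subset subset_union_left hbu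
      exact hne₁ (Subset.antisymm hWu huW)
    · rw [h1, h2]
  have hchain : ∀ b ∈ below P r, ∀ b' ∈ below P r, a ∪ b ⊆ a ∪ b' ∨ a ∪ b' ⊆ a ∪ b := by
    intro b hb b' hb'
    rcases val ha hb with h1 | h1 <;> rcases val ha hb' with h2 | h2
    · exact Or.inl (by rw [h1, h2])
    · exact Or.inl (by rw [h1, h2]; exact huW)
    · exact Or.inr (by rw [h1, h2]; exact huW)
    · exact Or.inl (by rw [h1, h2])
  have := two_mul_card_below_le_card_newMeets_of_union_eq hanti ha ha' hne heq hchain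
  omega

/-- For three members below: `newJoins ≤ 1 ⟹ newLabels ≥ 3 + newJoins`, in particular `newJoins = 0 ⟹ newLabels ≥ 6` and
`newJoins = 1 ⟹ newLabels ≥ 4`; so the `2 + 3` lemmas may assume two new joins. [this work] -/
theorem four_le_newLabels_of_two_three_newJoins_le_one (hanti : IsAntichain (· ⊆ ·) (P : Set (Finset α)))
    (h2 : #(above P r) = 2) (h3 : #(below P r) = 3) (hy : #(newJoins P r) ≤ 1) : 4 ≤ newLabels P r := by
  unfold newLabels
  by_cases h0 : newJoins P r = ∅
  · have := two_mul_card_below_le_card_newMeets_of_newJoins_eq_empty hanti h2 h0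
    omega
  · have h1 : 1 ≤ #(newJoins P r) := card_pos.2 (nonempty_iff_ne_empty.2 h0)
    have := card_below_le_card_newMeets_of_newJoins_le_one hanti h2 hy
    omega

end TwoAbove

end Summit.CriticalPhenomena.PercolationContinuityZ3.Theorems.SahiColouredDaykin
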